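import Summits.CriticalPhenomena.SAWScalingLimit.Theses.SAWConfRestriction

/-!
# `TargetOfCruxes` (stmt-CriticalPhenomena-14138): the three cruxes of `SAWConfRestriction` give its target

Support item stmt-CriticalPhenomena-14138 of route `SAWConfRestriction` (route-choice repair, option (a)): pure logic.
`ConfCovLimit` provides a chordal family `P` with (lim) and (conf); `RestrictionOfLimit` and `SimpleOfLimit`, applied to
that `P`, give (restr) and (simple); the target is the existence of such a `P` with all four clauses.
No mathematics; landed so that the item closes.
-/

namespace Summit.CriticalPhenomena.SAWScalingLimit.Theorems

open Summit.CriticalPhenomena.SAWScalingLimit.Theses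

/-- **`TargetOfCruxes` (stmt-CriticalPhenomena-14138)**: `ConfCovLimit → RestrictionOfLimit → SimpleOfLimit → Target` for
route `SAWConfRestriction` — take the chordal family from `ConfCovLimit` and apply the two `∀`-cruxes to it. [folklore] -/
theorem ConfRestrictionTargetOfCruxes_proof : SAWConfRestriction.TargetOfCruxes := by
  intro hcc hr hs
  obtain ⟨P, hch, hlim, hconf⟩ := hcc
  exact ⟨P, hch, hlim, hconf, hr P hch hlim, hs P hch hlim⟩

end Summit.CriticalPhenomena.SAWScalingLimit.Theorems
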